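import Mathlib

/-!
# Box bound for iterated sumsets of exponent-matrix evaluations

Soloist (informed) cap on the "sumset expansion" engine for elusive monomial maps
(A. K. Narayanan, *Arithmetic circuit lower bounds from sumset expansion*, arXiv:2607.15848, Def. 2):
for an exponent matrix `A ∈ ℕ^{m × n}` with entries `≤ H`, a "big vector" `β ∈ ℕ^n` and `ℓ ≥ 1`, the
iterated sumset `ℓ≤(Aβ)` (all sums of between `1` and `ℓ` entries, with repetition, of the evaluation
vector `Aβ`) has at most `(ℓ·H + 1)^n` elements — for EVERY `β` — because each such sum
`∑ᵢ cᵢ (Aβ)ᵢ = ⟨Aᵀc, β⟩` is a function of the transposed coefficient vector `Aᵀc ∈ {0,…,ℓH}^n`.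
Consequence (solo note `paper/hf-ceiling.md`, Cor. 5): an `(m, n, ℓ, C)`-expander in the sense of Def. 2
has `C ≤ (ℓH+1)^n`; in particular the `(m, n, s/r, 4^s)`-expanders with entries `≤ 2^{n^{O(1)}}` and
`s = n^{ω(1)}` hypothesised in Theorem 2 there do not exist for large `n`, and no Hilbert-function /
sumset-expansion certificate reaches the regime of Raz's `VP ≠ VNP` transfer (`Raz2010_result_1`).
This file proves only the finite box bound; it implies nothing toward the summit (it is negative
knowledge about one method). [cite: Narayanan2026, Def. 2, Thm 2; Raz2010, §1 result 1]
-/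

namespace Summit.ValiantsHypothesis.ValiantsHypothesis.Theorems

open Finset

/-- Coefficient vectors `c : Fin m → ℕ` with `1 ≤ ∑ c ≤ ℓ` (entries are then automatically `≤ ℓ`;
we carve them out of the box `{0,…,ℓ}^m`). [folklore] -/
def soloCoeffVecs (m ℓ : ℕ) : Finset (Fin m → ℕ) :=
  (Fintype.piFinset fun _ : Fin m => Finset.range (ℓ + 1)).filter
    (fun c => 1 ≤ ∑ i, c i ∧ ∑ i, c i ≤ ℓ)

/-- Narayanan's iterated sumset `ℓ≤(Aβ)` (arXiv:2607.15848, §1.3 and Def. 2): all sums of between `1`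
and `ℓ` entries, with repetition, of the evaluation vector `(Aβ)ᵢ = ∑ⱼ A i j * β j`, written as
`∑ᵢ cᵢ (Aβ)ᵢ` over coefficient vectors `c` with `1 ≤ |c| ≤ ℓ`. [cite: Narayanan2026, Def. 2] -/
def soloIterSumset {m n : ℕ} (A : Fin m → Fin n → ℕ) (β : Fin n → ℕ) (ℓ : ℕ) : Finset ℕ :=
  (soloCoeffVecs m ℓ).image (fun c => ∑ i, c i * ∑ j, A i j * β j)

/-- Every coefficient vector with `|c| ≤ ℓ` and entries of `A` bounded by `H` has transposed image
`(Aᵀc)ⱼ = ∑ᵢ cᵢ A i j ≤ ℓ·H`. [folklore] -/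
theorem soloInformed_transpose_apply_le {m n : ℕ} (A : Fin m → Fin n → ℕ) {ℓ H : ℕ}
    (hA : ∀ i j, A i j ≤ H) {c : Fin m → ℕ} (hc : ∑ i, c i ≤ ℓ) (j : Fin n) :
    ∑ i, c i * A i j ≤ ℓ * H := by
  calc ∑ i, c i * A i j ≤ ∑ i, c i * H :=
        Finset.sum_le_sum fun i _ => Nat.mul_le_mul_left _ (hA i j)
    _ = (∑ i, c i) * H := (Finset.sum_mul ..).symm
    _ ≤ ℓ * H := Nat.mul_le_mul_right _ hc

/-- **Box bound** (solo note `hf-ceiling.md`, Cor. 5): `|ℓ≤(Aβ)| ≤ (ℓ·H + 1)^n` for every exponent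
matrix `A` with entries `≤ H`, every big vector `β` and every `ℓ`. Hence an `(m,n,ℓ,C)`-expander in
the sense of Narayanan's Def. 2 must have `C ≤ (ℓH+1)^n`. [cite: Narayanan2026, Def. 2] -/
theorem soloInformed_iterSumset_card_le {m n : ℕ} (A : Fin m → Fin n → ℕ) (β : Fin n → ℕ)
    (ℓ H : ℕ) (hA : ∀ i j, A i j ≤ H) :
    (soloIterSumset A β ℓ).card ≤ (ℓ * H + 1) ^ n := by
  classical
  -- ψ : c ↦ Aᵀc, landed in the box `{0,…,ℓH}^n` via `% (ℓH+1)` (a no-op on the relevant vectors)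
  let ψ : (Fin m → ℕ) → (Fin n → Fin (ℓ * H + 1)) := fun c j =>
    ⟨(∑ i, c i * A i j) % (ℓ * H + 1), Nat.mod_lt _ (Nat.succ_pos _)⟩
  -- φ : v ↦ ⟨v, β⟩
  let φ : (Fin n → Fin (ℓ * H + 1)) → ℕ := fun v => ∑ j, (v j : ℕ) * β j
  have hfac : ∀ c ∈ soloCoeffVecs m ℓ, (∑ i, c i * ∑ j, A i j * β j) = φ (ψ c) := by
    intro c hc
    have hsum : ∑ i, c i ≤ ℓ := ((Finset.mem_filter.mp hc).2).2
    have hmod : ∀ j, (∑ i, c i * A i j) % (ℓ * H + 1) = ∑ i, c i * A i j := fun j =>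
      Nat.mod_eq_of_lt (Nat.lt_succ_of_le (soloInformed_transpose_apply_le A hA hsum j))
    simp only [φ, ψ, hmod]
    simp_rw [Finset.mul_sum, Finset.sum_mul]
    rw [Finset.sum_comm]
    exact Finset.sum_congr rfl fun j _ => Finset.sum_congr rfl fun i _ => by ring
  have himg : soloIterSumset A β ℓ = (soloCoeffVecs m ℓ).image (φ ∘ ψ) := by
    unfold soloIterSumset
    exact Finset.image_congr fun c hc => hfac c hc
  calc (soloIterSumset A β ℓ).card
      = ((soloCoeffVecs m ℓ).image (φ ∘ ψ)).card := by rw [himg]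
    _ = (((soloCoeffVecs m ℓ).image ψ).image φ).card := by rw [Finset.image_image]
    _ ≤ ((soloCoeffVecs m ℓ).image ψ).card := Finset.card_image_le
    _ ≤ (Finset.univ : Finset (Fin n → Fin (ℓ * H + 1))).card :=
        Finset.card_le_card (Finset.subset_univ _)
    _ = (ℓ * H + 1) ^ n := by simp

end Summit.ValiantsHypothesis.ValiantsHypothesis.Theorems
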